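import Summits.BirchSwinnertonDyer.BirchSwinnertonDyer.Theses.SignedLowerHalves
import Summits.BirchSwinnertonDyer.BirchSwinnertonDyer.Theorems.SignedLowerHalvesKobayashiLowerHalfLargeImagePairedDescent
import Mathlib.NumberTheory.LegendreSymbol.JacobiSymbol
import HarnessLib

/-!
# Line `lower-chamber-door` for crux 3 `KobayashiLowerHalfLargeImage` (item `stmt-BirchSwinnertonDyer-19001`)
— ideator K1 gen 23; PUBLISHED via `ledger crux write` ONLY, NOT registered with `ledger skeleton check`
(W-79: a lead is seated; line of record = `Lines/kurihara_rigidity.lean`). Card: `Ideas/lower-chamber-door.md`,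
line card `Lines/lower_chamber_door.md`.

HONEST FRAMING (D-0152): the crux feeds the CLASS route `SignedLowerHalves`; BSD is not proved; every `stub_*`
below is an OPEN obligation carried by `sorry`; the composition `KobayashiLowerHalfLargeImage_of` only certifies
that the stubs, if proved, give the crux BY NAME. Nothing restates or weakens the crux.

THE LINE (Burungale–Skinner–Tian–Wan, arXiv:2409.01350, Thm. 2.5 (def), transplanted to X7). For an X7 pair
`(W, p)`, `p ≥ 5`, `a_p = 0`, `ρ̄` onto, with a `ρ̄`-RAMIFIED Steinberg prime `ℓ ∉ {2, p}` of EITHER sign, take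
`L = ℚ(√-D)` with `p` split, `ℓ` inert, all other bad primes split (`IsDefConfig`). Engine `stub_lowerChamber`
(internal structure, see the line card): (E1) Fouquet–Wan 2021 Thm. 7.32(i) — Greenberg IMC lower bound over `L`
up to pullbacks of height-one primes of `O⟦Γ⁺⟧` [PRE]; (E2) BSTW §5 / proof of Prop. 1.18 — Λ_L-linear conversion
to the signed divisibility in `Λ_L ⊗_{Λ^cyc} Frac(Λ^cyc)` [PRE]; (E3) W-def — `μ = 0` of the definite signed theta
element `𝓛^±_W` on `B_{ℓ∞}` with Eichler level `N⁺ ⊇` additive primes, which IS the anticyclotomic restriction of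
the signed function, so pullback primes die (no forced zero in this chamber) [NEW at general `N⁺`; square-free:
Pollack–Weston 2011; ordinary general `N⁺`: Vatsal 2003 + Kim–Ota 2023]; (E4) control mod `(γ_ac - 1)` (BSTW
Prop. 2.7) ⇒ the PAIRED lower half on the cyclotomic line [PRE]. Then the landed door
`X7.kobayashiLowerDivisibility_of_paired_twist` (here `stub_pairedDoor`, published inputs only; proved modulo
them as `pairedDoor_of_pub`). Residues, honestly named and NOT attacked: (CR⁺)(6) violators
(`stub_crViolators`, expected removable à la KPW17 / BBL Rem. 7.11), pairs with no `ρ̄`-ramified odd Steinberg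
prime `≠ p` (`stub_noRamifiedSteinberg` = classes D ∪ E and the `ρ̄`-unramified-Steinberg pairs), `p = 3`
(`stub_three`).
-/

set_option autoImplicit false
set_option linter.dupNamespace false

noncomputable section

open scoped Classical MatrixGroups ModularForm

open CongruenceSubgroup WeierstrassCurve Literature.NumberTheory.EllipticCurves
  Literature.NumberTheory.EllipticCurves.ModularForms
  Literature.NumberTheory.EllipticCurves.Rank1Residual
  Literature.NumberTheory.EllipticCurves.Rank1Residual.Typed
  Literature.NumberTheory.EllipticCurves.Kobayashi2003 ZpExtension
  Summit.BirchSwinnertonDyer.Rank1Residual.Supersingular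
  Summit.BirchSwinnertonDyer.BirchSwinnertonDyer.Theorems

namespace Summit.BirchSwinnertonDyer.BirchSwinnertonDyer.Cruxes.KobayashiLowerHalfLargeImage

namespace LowerChamberDoor

/-! ### Vocabulary (ℚ-currency; identical to the idea's `Sketch.lean`) -/

/-- The (def) configuration for `L = ℚ(√-D)` relative to `(W, p, ℓ)`: `D` prime, `D ≡ 7 (mod 8)` (so `2`
splits and `-D` is a fundamental discriminant), `D ∉ {p, ℓ}`, `D ∤ N`, `p` SPLIT, `ℓ` INERT, every other
odd prime of the conductor SPLIT (additive primes included). -/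
def IsDefConfig (W : WeierstrassCurve ℚ) [W.IsElliptic] (p ℓ D : ℕ) : Prop :=
  D.Prime ∧ D % 8 = 7 ∧ D ≠ p ∧ D ≠ ℓ ∧ ¬ (D ∣ W.conductorNorm ℤ) ∧
    jacobiSym (-(D : ℤ)) p = 1 ∧ jacobiSym (-(D : ℤ)) ℓ = -1 ∧
    ∀ r : ℕ, r.Prime → r ≠ 2 → r ≠ ℓ → r ∣ W.conductorNorm ℤ → jacobiSym (-(D : ℤ)) r = 1

/-- Kim–Ota (arXiv:1905.02926) Assumption 5.3 (6), curve language: a multiplicative prime `q ≡ 1 (mod p)`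
is `ρ̄`-ramified (`p ∤ ord_q Δ_min`). -/
def CRPlusSix (W : WeierstrassCurve ℚ) [W.IsElliptic] [W.IsGloballyMinimal] (p : ℕ) : Prop :=
  ∀ (q : ℕ) [Fact q.Prime], W.HasMultiplicativeReductionAtPrime q → q % p = 1 →
    ¬ p ∣ padicValInt q W.minimalDiscriminantInt

/-! ### Statements of the stubs -/

/-- `stub_defField` (support, size S, kernel-closable: CRT + Dirichlet + quadratic reciprocity): for distinct
odd primes `p, ℓ` a (def)-configured prime `D` exists. -/
def DefFieldStatement : Prop :=
  ∀ (W : WeierstrassCurve ℚ) [W.IsElliptic] (p ℓ : ℕ), p.Prime → ℓ.Prime → p ≠ 2 → ℓ ≠ 2 → p ≠ ℓ →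
    ∃ D : ℕ, IsDefConfig W p ℓ D

/-- `stub_lowerChamber` — THE ENGINE (OPEN; load-bearing). For every X7 pair `(W, p)`, `p ≥ 5`, `a_p = 0`,
`ρ̄` onto, no CM, (CR⁺)(6), every `ρ̄`-ramified Steinberg prime `ℓ ∉ {2, p}` (either sign of `a_ℓ`), every
(def)-configured `D` and every globally minimal model `W'` of `W^{(-D)}`: the PAIRED signed lower half
`L_p^ε(E)·L_p^ε(E^{(-D)}) ∣ char X^ε(E)·char X^ε(E^{(-D)})` in `ℤ_p⟦T⟧ ⊗ ℚ`, both signs. Internal structure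
(E1)–(E4) in the module docstring; (E3) = W-def is the new mathematics. -/
def LowerChamberStatement : Prop :=
  ∀ (W : WeierstrassCurve ℚ) [W.IsElliptic] [W.IsGloballyMinimal] (p : ℕ) [Fact p.Prime],
    5 ≤ p → ClassX7 W p → ¬ W.HasCM → W.frobeniusTrace p = 0 → Surj W p → CRPlusSix W p →
    ∀ (ℓ : ℕ) [Fact ℓ.Prime], ℓ ≠ 2 → ℓ ≠ p → W.HasMultiplicativeReductionAtPrime ℓ →
      ¬ p ∣ padicValInt ℓ W.minimalDiscriminantInt →
    ∀ D : ℕ, IsDefConfig W p ℓ D →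
    ∀ (W' : WeierstrassCurve ℚ) [W'.IsElliptic] [W'.IsGloballyMinimal] (C : VariableChange ℚ),
      C • W' = W.quadraticTwist ((-(D : ℤ) : ℤ) : ℚ) →
    ∀ ε : ℤˣ, PairedKobayashiLowerDivisibility W W' p ε

/-- `stub_pairedDoor` (published inputs only): the landed door `X7.kobayashiLowerDivisibility_of_paired_twist`
for the twist parameter `d = -D`, modulo exactly the NAMED published facts it consumes (Kobayashi 2003 Thms
1.2 / 4.1 at the twist, Pollack 2003, modularity, the period unit, Wuthrich 2014 Lemma 20) — see
`pairedDoor_of_pub` (proved, no sorry). -/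
def PairedDoorStatement : Prop :=
  ∀ (W : WeierstrassCurve ℚ) [W.IsElliptic] [W.IsGloballyMinimal] (p : ℕ) [Fact p.Prime],
    5 ≤ p → ClassX7 W p → W.frobeniusTrace p = 0 → Surj W p →
    ∀ (D : ℕ), D.Prime → D ≠ p →
    ∀ (W' : WeierstrassCurve ℚ) [W'.IsElliptic] [W'.IsGloballyMinimal] (C : VariableChange ℚ),
      C • W' = W.quadraticTwist ((-(D : ℤ) : ℤ) : ℚ) →
    ∀ ε : ℤˣ, PairedKobayashiLowerDivisibility W W' p ε → KobayashiLowerDivisibility W p ε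

/-- `stub_crViolators` (residue, size S–M; expected removable by level-lowering `f ↦ g (mod p)` to a
(CR⁺)-clean newform as in Kim–Pollack–Weston 2017 / BBL Rem. 7.11): pairs carrying a `ρ̄`-ramified odd
Steinberg prime `≠ p` but violating (CR⁺)(6). -/
def CRViolatorStatement : Prop :=
  ∀ (W : WeierstrassCurve ℚ) [W.IsElliptic] [W.IsGloballyMinimal] (p : ℕ) [Fact p.Prime],
    5 ≤ p → ClassX7 W p → ¬ W.HasCM → W.frobeniusTrace p = 0 → Surj W p →
    (∃ (ℓ : ℕ) (_ : Fact ℓ.Prime), ℓ ≠ 2 ∧ ℓ ≠ p ∧ W.HasMultiplicativeReductionAtPrime ℓ ∧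
        ¬ p ∣ padicValInt ℓ W.minimalDiscriminantInt) →
    ¬ CRPlusSix W p → ∃ ε : ℤˣ, KobayashiLowerDivisibility W p ε

/-- `stub_noRamifiedSteinberg` (residue, NOT ATTACKED by this line): X7 large-image pairs at `p ≥ 5` whose
curve has NO `ρ̄`-ramified odd Steinberg prime `≠ p` — the pure-additive classes D ∪ E and the pairs all of
whose Steinberg primes have `p ∣ ord Δ` — the population of the line of record and of the other lines. -/
def NoRamifiedSteinbergStatement : Prop :=
  ∀ (W : WeierstrassCurve ℚ) [W.IsElliptic] [W.IsGloballyMinimal] (p : ℕ) [Fact p.Prime],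
    5 ≤ p → ClassX7 W p → ¬ W.HasCM → W.frobeniusTrace p = 0 → Surj W p →
    (∀ (ℓ : ℕ) [Fact ℓ.Prime], ℓ ≠ 2 → ℓ ≠ p → W.HasMultiplicativeReductionAtPrime ℓ →
        p ∣ padicValInt ℓ W.minimalDiscriminantInt) →
    ∃ ε : ℤˣ, KobayashiLowerDivisibility W p ε

/-- `stub_three` (residue `p = 3`; identical to the `p = 3` residues of the lines hilbert-door,
crossing-rigidity, cartan-chamber). -/
def ThreeStatement : Prop :=
  ∀ (W : WeierstrassCurve ℚ) [W.IsElliptic] [W.IsGloballyMinimal] (p : ℕ) [Fact p.Prime],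
    p = 3 → ClassX7 W p → ¬ W.HasCM → W.frobeniusTrace p = 0 → Surj W p →
    ∃ ε : ℤˣ, KobayashiLowerDivisibility W p ε

/-! ### The stubs (each `sorry` is an open obligation of the line) -/

/-- [cite: Dirichlet's theorem — Mathlib `Nat.setOf_prime_and_eq_mod_infinite`; quadratic reciprocity
`jacobiSym.quadratic_reciprocity`] -/
theorem stub_defField : DefFieldStatement := by
  sorry

/-- [claim: FouquetWan2021 Thm. 7.32(i), status: under-review] [cite: BurungaleSkinnerTianWan2024
(arXiv:2409.01350), Thm. 2.5 (def), Prop. 1.18, §5, Prop. 2.7] [cite: Vatsal2003Duke, Thm. 1.1]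
[cite: PollackWeston2011, Thm. 2.5 / 1.1] [cite: KimOta2023 (arXiv:1905.02926), Thm. 1.3, Thm. 5.5, Rem. 6.5] -/
theorem stub_lowerChamber : LowerChamberStatement := by
  sorry

/-- [cite: Kobayashi2003, Thm. 1.2, Thm. 4.1] [cite: Pollack2003, Cor. 5.11] [cite: Wuthrich2014, Lemma 20]
— bookkeeping modulo named published facts: `pairedDoor_of_pub`. -/
theorem stub_pairedDoor : PairedDoorStatement := by
  sorry

/-- [cite: KimPollackWeston2017] [cite: BurungaleBuyukbodukLei2022 (arXiv:2211.03722), Rem. 7.11] -/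
theorem stub_crViolators : CRViolatorStatement := by
  sorry

/-- NOT ATTACKED (other lines' population). -/
theorem stub_noRamifiedSteinberg : NoRamifiedSteinbergStatement := by
  sorry

/-- NOT ATTACKED (`p = 3`). -/
theorem stub_three : ThreeStatement := by
  sorry

/-! ### Proved anchors (no sorry) -/

/-- The twist parameter `d = -D` is admissible for the door: square-free and `p ∤ 2d` (`p ≥ 5`, `D ≠ p`). -/
theorem twistParam_admissible {p D : ℕ} (hp : p.Prime) (hp5 : 5 ≤ p) (hD : D.Prime) (hDp : D ≠ p) :
    Squarefree (-(D : ℤ)) ∧ ¬ (p : ℤ) ∣ 2 * (-(D : ℤ)) := by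
  refine ⟨?_, ?_⟩
  · rw [← Int.squarefree_natAbs]
    simpa using hD.prime.squarefree
  · intro h
    rw [mul_neg, dvd_neg] at h
    have h' : p ∣ 2 * D := by exact_mod_cast h
    rcases (Nat.Prime.dvd_mul hp).1 h' with h2 | hd
    · have := Nat.le_of_dvd (by norm_num) h2
      omega
    · exact hDp ((Nat.prime_dvd_prime_iff_eq hp hD).1 hd).symm

/-- `stub_pairedDoor` IS bookkeeping modulo the named published inputs: the landed door, instantiated. -/
theorem pairedDoor_of_pub
    (h12 : Kobayashi2003.thm12_signedSelmerDual_finite_torsion)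
    (h41 : Kobayashi2003.thm41_signedCharIdeal_divisibility)
    (hPollack : ∀ (V : WeierstrassCurve ℚ) [V.IsElliptic] [V.IsGloballyMinimal] (p : ℕ) [Fact p.Prime]
      {N : ℕ} [NeZero N] {f : CuspForm (Gamma0 N) 2},
      pollack_exists_plusMinusPAdicLFunction (W := V) (f := f) (p := p))
    (hmod : nonempty_modularParametrizationData)
    (h5 : realPeriodRat_eq_unit_mul_plusPeriod) (h3 : realPeriodRat_eq_unit_mul_plusPeriod_three)
    (hL20 : Wuthrich2014.lemma20_surjective_threeAdic_of_semistable) :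
    PairedDoorStatement := by
  intro W _ _ p _ hp5 hX hap hs D hD hDp W' _ _ C hC ε hpair
  have hp : p ≠ 2 := by omega
  obtain ⟨hd, hpd⟩ := twistParam_admissible (Fact.out : p.Prime) hp5 hD hDp
  exact X7.kobayashiLowerDivisibility_of_paired_twist W W' p h12 h41 (hPollack W' p) hmod h5 h3 hL20 hp
    hX hap hs hd hpd hC hpair

/-! ### Composition -/

/-- COMPOSITION, explicit form (bookkeeping; conclusion = the crux UNFOLDED). An odd prime is `3` or `≥ 5`; at
`p ≥ 5` either `W` has a `ρ̄`-ramified odd Steinberg prime `ℓ ≠ p` — then either (CR⁺)(6) holds, a (def) prime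
`D` exists (`DefFieldStatement`), `W^{(-D)}` has a globally minimal model (tree,
`exists_isGloballyMinimal_smul_eq_quadraticTwist`), the engine gives the paired lower half and the door
separates the factor of `W`; or (CR⁺)(6) fails (`CRViolatorStatement`) — or it has none
(`NoRamifiedSteinbergStatement`); `p = 3` is `ThreeStatement`. -/
theorem lowerHalf_of_stubs (hF : DefFieldStatement) (hG : LowerChamberStatement)
    (hD : PairedDoorStatement) (hV : CRViolatorStatement) (hN : NoRamifiedSteinbergStatement)
    (h3 : ThreeStatement) :
    ∀ (W : WeierstrassCurve ℚ) [W.IsElliptic] [W.IsGloballyMinimal] (p : ℕ) [Fact p.Prime],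
      p ≠ 2 → ClassX7 W p → ¬ W.HasCM → W.frobeniusTrace p = 0 → Surj W p →
      ∃ ε : ℤˣ, KobayashiLowerDivisibility W p ε := by
  intro W _ _ p _ hp2 hX hcm hap hs
  have hpP : p.Prime := Fact.out
  by_cases hp5 : 5 ≤ p
  · by_cases hℓ : ∃ (ℓ : ℕ) (_ : Fact ℓ.Prime), ℓ ≠ 2 ∧ ℓ ≠ p ∧ W.HasMultiplicativeReductionAtPrime ℓ ∧
        ¬ p ∣ padicValInt ℓ W.minimalDiscriminantInt
    · by_cases hCR : CRPlusSix W p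
      · obtain ⟨ℓ, hℓF, hℓ2, hℓp, hmult, hram⟩ := hℓ
        obtain ⟨D, hDc⟩ := hF W p ℓ hpP hℓF.out hp2 hℓ2 (Ne.symm hℓp)
        have hD0 : (D : ℚ) ≠ 0 := by exact_mod_cast hDc.1.ne_zero
        have hd0 : ((-(D : ℤ) : ℤ) : ℚ) ≠ 0 := by push_cast; exact neg_ne_zero.mpr hD0
        obtain ⟨W', hE', hM', C, hC⟩ := exists_isGloballyMinimal_smul_eq_quadraticTwist W hd0
        have hpair : PairedKobayashiLowerDivisibility W W' p 1 :=
          hG W p hp5 hX hcm hap hs hCR ℓ hℓ2 hℓp hmult hram D hDc W' C hC 1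
        exact ⟨1, hD W p hp5 hX hap hs D hDc.1 hDc.2.2.1 W' C hC 1 hpair⟩
      · exact hV W p hp5 hX hcm hap hs hℓ hCR
    · exact hN W p hp5 hX hcm hap hs (fun ℓ _ h2 hp hm ↦ by
        by_contra hv
        exact hℓ ⟨ℓ, ‹_›, h2, hp, hm, hv⟩)
  · have hp3 : p = 3 := by
      have h2 := hpP.two_le
      interval_cases p
      · exact absurd rfl hp2
      · rfl
      · exact absurd hpP (by decide)
    exact h3 W p hp3 hX hcm hap hs

/-- THE SKELETON: the crux BY NAME from exactly the six stubs (no sorry of its own). -/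
theorem KobayashiLowerHalfLargeImage_of :
    Summit.BirchSwinnertonDyer.BirchSwinnertonDyer.Theses.SignedLowerHalves.KobayashiLowerHalfLargeImage :=
  lowerHalf_of_stubs stub_defField stub_lowerChamber stub_pairedDoor stub_crViolators
    stub_noRamifiedSteinberg stub_three

/-- The same composition with the stubs as HYPOTHESES (the shape a registered skeleton's `_of` takes). -/
theorem KobayashiLowerHalfLargeImage_of_hyps (hF : DefFieldStatement) (hG : LowerChamberStatement)
    (hD : PairedDoorStatement) (hV : CRViolatorStatement) (hN : NoRamifiedSteinbergStatement)
    (h3 : ThreeStatement) :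
    Summit.BirchSwinnertonDyer.BirchSwinnertonDyer.Theses.SignedLowerHalves.KobayashiLowerHalfLargeImage :=
  lowerHalf_of_stubs hF hG hD hV hN h3

end LowerChamberDoor

end Summit.BirchSwinnertonDyer.BirchSwinnertonDyer.Cruxes.KobayashiLowerHalfLargeImage
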